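import Summits.QuantumFields.BalabanUV.Beta.D1BFx.WardJetsUnpacked
import Summits.QuantumFields.BalabanUV.Beta.D1BFx.ColourLift

/-!
# `BalabanUV.Beta.D1BFx.ColourVectorLift` — road «BF-x» for binder row D1, slot (K), chain step (I) «(A1)-PACKED», brick **«AD-E3-LIFT»** PART A
# (owner ruling ρ-g16-1′, journal [D1P2-G16-WORDS-4], = repair (γ₁) of `HOME/b2b-balaban-beta-d1-formalise-leaf-03/g20/Q-A1P-1-ANSWER.md`), THE GENERIC
# HALF (definition-free): COLOUR-VECTOR-VALUED RESPONSES.  For ANY colour family `C : l → Matrix l l ℝ` and colour vector `θ` with `(Σ θ•C) θ = 0`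
# (the generator kills the response's colour — `ad(θ)θ = 0`), the Kronecker packing lemmas and `WardJetsFromNoether.packedWard₁∕₂` RE-RUN over
# `l × σ`-indexed lifted families: the packed first jet is `C_θ ⊗ kₛ`, the second response's source `(C_θ θ) ⊗ (kₜ rₛ)` VANISHES, so the packed
# second jet has NO odd part, the parity defect `R` of `PackedWardParitySplit` is ZERO, and the EVEN tuple's mixed Ward letter is a THEOREM of the
# lifted table-level letters [P1′]∕[P2′] — colourlessly `k_e·Ŵ₀ + kₛ·Ŵₜ + kₜ·Ŵₛ + 𝕄₀·w_e = 0`, the packed-form `aₛₜ`∕`bₛₜ` input of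
# `KCombineCovColourTorus.identity_array_currency_cov_What0_stripped` for packed data.  PART B (`ColourLiftAdE3`, definition lane) is the instance
# `l = Fin 3`, `C 2 = c₃ = ad e₃`, `θ = e₃`.

HONEST DEPENDENCY (cell records, verbatim): «continuum YM on T⁴ ⇐ BetaPertH ∧ nine spine estimates (0/9 proved); BetaPertH ⇐ (D1) ∧ (D4) ∧
CAP+tail; G-an2-4 gates asym, D1 and NE2/3/4.»  HONEST FRAMING (cell contract, verbatim): «discharging `BetaPertH` makes Bałaban's UV stability
UNCONDITIONAL — a real constructive-QFT result; it is NOT the continuum limit and NOT the Clay problem.»  THIS MODULE DISCHARGES NOTHING of (K),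
of D1 or of the wall: [folklore] finite-dimensional matrix algebra (Mathlib's `Matrix.kroneckerMap` API) over ABSTRACT data and the tree's
`WardJetsFromNoether` (`oslot`, `packedWard₁`, `packedWard₂`), `WardJetsUnpacked` (block bookkeeping) and `ColourLift` BY NAME (the cancellation of a nonzero Kronecker factor is `PackedWardLiftOddDrop.kronecker_eq_zero_iff_right`, re-derived inline to keep the import light).  No definition, no `def … : Prop`,
nothing cited, 0 sorry.  It instantiates NO table of the cell; the lifted table-level letters [P1′]∕[P2′] and the first-order source conditions
are HYPOTHESES here exactly as [P1]∕[P2]∕`hs₂`∕`ht₂` are in `packedWard₂` — what is NEW is that `hst` and the odd part are DISCHARGED (they are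
`0 = 0`) and that the conclusion is the letter of the EVEN tuple ALONE.  [P1′]∕[P2′] are NOT consequences of the colourless [P1]∕[P2] (PART 1
`PackedWardParitySplit` shows those over-count `R`; they are the letters of a DIFFERENT, abelian-like model); which table-level identities the
literal's tables satisfy in lifted form is an2's Q-A1P-2, not decided here.  NOT D1, NOT BetaPertH, NOT continuum, NOT Clay.

ABSOLUTE RULE (cell charter, verbatim): «No internally-minted statement may enter as a cited fact. Every hypothesis is either kernel-proved in this
package or a verbatim quotation of a PUBLISHED theorem with page reference. The manuscript(s) under audit are NOT citable for their own disputed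
steps — they are the thing under adjudication; programme-internal (2001/route/tribunal) claims are never citable.»

WHY (PART 1∕2 of this lineage's Q-A1P-1 check, `PackedWardParitySplit` ∕ `PackedWardLiftOddDrop`, and the owner's ρ-g16-1′).  In the colourless
currency the two halves of `packedWard₂` miss their letters by `∓R`, `R = oslot X₁ (𝕄ₜ *ᵥ rₛ) ≠ 0`, and no `cgen`-dressing of the packed second jets
meets K-TA4G's two-sided letters; the genuine colour factor of `R` and of the second response is a COMMUTATOR, which vanishes for ONE generator — but
only if the response carries a colour VECTOR the generator kills.  WHICH `cgen` FACTS THE STRIPPED IDENTITY CONSUMES (owner's ask): outside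
`ColourLift` only `trace_cgen_mul_cgen` (`KCombineCovColour` l.260, `KCombineCovColourSrc` l.300, `KCombineCovColourTorus` l.134 — the `tr(c·c) = −2`
cancellation); the stripped identities are COLOUR-FREE statements and are NOT re-proved: this model only DERIVES their colourless letters for the
packed even tuple (§4), after which they apply verbatim.

CONTENT (all [folklore]).
* §2 KRONECKER PACKING: **`sum_smul_kronecker_pack`** (`Σ_{(γ,k)} θ_γ r_k • (C γ ⊗ T k) = (Σ θ•C) ⊗ (Σ r•T)`), **`sum_sum_smul_kronecker_pack₂`**
  (bilinear, colour factor `C γ · C δ`), **`kronecker_mulVec_tensor`** (`(c ⊗ K)(θ ⊗ v) = (cθ) ⊗ (Kv)`), `kronecker_mulVec_tensor_eq_zero`,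
  `one_kronecker_mulVec_tensor`.
* §3 **`packedWard₂_lift_even`** — `packedWard₂` over `σ′ = l × σ` at `𝕄₀′ = 1⊗𝕄₀`, `𝕄₁′ (γ,k) = C γ ⊗ 𝕄₁ k`, `X₁′ (γ,k) = C γ ⊗ X₁ k`,
  `Ŵ₀′ = 1⊗Ŵ₀`, GENERAL second tables `𝕄₂′`, `X₂′`, weights `θ ⊗ rₛ`, `θ ⊗ rₜ`, second weight `0`: `hst` DISCHARGED, conclusion = the lifted mixed
  letter of the EVEN tuple `K_e′ (1⊗Ŵ₀) + (C_θ⊗kₛ)(C_θ⊗wₜ) + (C_θ⊗kₜ)(C_θ⊗wₛ) + (1⊗𝕄₀) W_e′ = 0`; **`packedWard₁_lift`** (first order).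
* §4 STRUCTURED second tables `𝕄₂′ = (C γ · C δ) ⊗ 𝕄₂ k l`, `X₂′ = (C γ · C δ) ⊗ X₂ k l`: **`packedWard₂_lift_even_kronecker`**
  (`(C_θ·C_θ) ⊗ (k_eŴ₀ + kₛwₜ + kₜwₛ + 𝕄₀w_e) = 0`), `eq_zero_of_kronecker_eq_zero`, and for `C_θ·C_θ ≠ 0` the COLOURLESS even letter
  **`packedWard₂_even_of_lift`**; first order **`packedWard₁_of_lift`** (`C_θ ≠ 0`).
* §4b the `ν ⊕ μ` READ-OUT: `unpack_mixed_letter`; **`ward₂_even_of_lift`** — at `kkt`-tables and field-rows generators, the binders `aₛₜ ∧ bₛₜ` of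
  the EVEN packed tuple (the shape `WardJetsUnpacked.ward₂` delivers for the full tuple, now for the even tuple with NO odd part).
NOT HERE (honest): the lifted source conditions for a concrete inverse (`WardJetsCombSources` pattern), the `ad e₃` instance (PART B), (B3),
periodisation.
Provenance: D1 formalisation swarm leaf seat `b2b-balaban-beta-d1-formalise-leaf-03` gen 20 (owner ruling ρ-g16-1′ «AD-E3 LIFT», WANTED), 2026-08-22.
-/

noncomputable section

namespace Summit.QuantumFields.BalabanUV.Beta.D1BFx.ColourVectorLift

open Matrix
open scoped BigOperators Kronecker
open Literature.MathematicalPhysics.QuantumFieldTheory.Balaban1983to89.Beta.Composition (kkt)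
open Summit.QuantumFields.BalabanUV.Beta.D1BFx.WardJetsFromNoether (oslot oslot_apply oslot_zero oslot_add packedWard₁ packedWard₂ sum_smul_kkt
  sum_smul_fromRows_zero kkt_mul_fromRows_zero fromRows_add_fromRows fromRows_eq_zero_iff)
open Summit.QuantumFields.BalabanUV.Beta.D1BFx.WardJetsUnpacked (sum_sum_smul_kkt sum_sum_smul_fromRows_zero)

/-! ## §2 Kronecker packing with colour-vector weights -/

section Pack

variable {l σ α ν ρ : Type*} [Fintype l] [Fintype σ] [Fintype ν]

omit [Fintype ν] in
/-- [folklore] **LINEAR PACKING**: colour-vector weights `θ ⊗ r` pack a lifted table family `C γ ⊗ T k` into ONE Kronecker product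
`(Σ θ•C) ⊗ (Σ r•T)` — the packed first jet `C_θ ⊗ kₛ`. -/
theorem sum_smul_kronecker_pack (θ : l → ℝ) (r : σ → ℝ) (C : l → Matrix l l ℝ) (T : σ → Matrix α ν ℝ) :
    ∑ p : l × σ, (θ p.1 * r p.2) • (C p.1 ⊗ₖ T p.2) = (∑ γ, θ γ • C γ) ⊗ₖ (∑ k, r k • T k) := by
  rw [Fintype.sum_prod_type]
  ext ⟨i, x⟩ ⟨j, y⟩
  simp only [Matrix.sum_apply, Matrix.smul_apply, Matrix.kroneckerMap_apply, smul_eq_mul, Finset.sum_mul, Finset.mul_sum]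
  rw [Finset.sum_comm]
  exact Finset.sum_congr rfl fun k _ => Finset.sum_congr rfl fun γ _ => by ring

omit [Fintype ν] in
/-- [folklore] **BILINEAR PACKING** with colour factor `C γ · C δ` on the second tables: weights `θ ⊗ r`, `θ′ ⊗ r′` pack
`(C γ · C δ) ⊗ T k l` into `((Σ θ•C)·(Σ θ′•C)) ⊗ (Σ r r′ • T)`. -/
theorem sum_sum_smul_kronecker_pack₂ (θ θ' : l → ℝ) (r r' : σ → ℝ) (C : l → Matrix l l ℝ) (T : σ → σ → Matrix α ν ℝ) :
    ∑ p : l × σ, ∑ q : l × σ, ((θ p.1 * r p.2) * (θ' q.1 * r' q.2)) • ((C p.1 * C q.1) ⊗ₖ T p.2 q.2)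
      = ((∑ γ, θ γ • C γ) * (∑ δ, θ' δ • C δ)) ⊗ₖ (∑ k, ∑ l', (r k * r' l') • T k l') := by
  -- inner sum: pack in `q`
  have h1 : ∀ p : l × σ, ∑ q : l × σ, ((θ p.1 * r p.2) * (θ' q.1 * r' q.2)) • ((C p.1 * C q.1) ⊗ₖ T p.2 q.2)
      = (θ p.1 * r p.2) • ((C p.1 * ∑ δ, θ' δ • C δ) ⊗ₖ (∑ l', r' l' • T p.2 l')) := by
    intro p
    have hq : ∀ q : l × σ, ((θ p.1 * r p.2) * (θ' q.1 * r' q.2)) • ((C p.1 * C q.1) ⊗ₖ T p.2 q.2)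
        = (θ p.1 * r p.2) • ((θ' q.1 * r' q.2) • ((C p.1 * C q.1) ⊗ₖ T p.2 q.2)) := fun q => by rw [smul_smul]
    have hD : C p.1 * ∑ δ, θ' δ • C δ = ∑ δ, θ' δ • (C p.1 * C δ) := by
      rw [Matrix.mul_sum]; exact Finset.sum_congr rfl fun δ _ => by rw [Matrix.mul_smul]
    simp_rw [hq]
    rw [← Finset.smul_sum, sum_smul_kronecker_pack θ' r' (fun δ => C p.1 * C δ) (fun l' => T p.2 l'), hD]
  simp_rw [h1]
  -- outer sum: pack in `p`
  rw [sum_smul_kronecker_pack θ r (fun γ => C γ * ∑ δ, θ' δ • C δ) (fun k => ∑ l', r' l' • T k l'), Matrix.sum_mul]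
  congr 1
  · exact Finset.sum_congr rfl fun γ _ => by rw [Matrix.smul_mul]
  · refine Finset.sum_congr rfl fun k _ => ?_
    rw [Finset.smul_sum]
    exact Finset.sum_congr rfl fun l' _ => by rw [smul_smul]

/-- [folklore] **A LIFTED MATRIX ON A COLOUR-VECTOR-VALUED VECTOR**: `(c ⊗ K)(θ ⊗ v) = (cθ) ⊗ (Kv)`. -/
theorem kronecker_mulVec_tensor (c : Matrix l l ℝ) (K : Matrix α ν ℝ) (θ : l → ℝ) (v : ν → ℝ) :
    (c ⊗ₖ K) *ᵥ (fun p : l × ν => θ p.1 * v p.2) = fun q : l × α => (c *ᵥ θ) q.1 * (K *ᵥ v) q.2 := by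
  ext ⟨i, x⟩
  simp only [Matrix.mulVec, dotProduct, Matrix.kroneckerMap_apply, Fintype.sum_prod_type, Finset.sum_mul, Finset.mul_sum]
  rw [Finset.sum_comm]
  exact Finset.sum_congr rfl fun k _ => Finset.sum_congr rfl fun γ _ => by ring

/-- [folklore] … hence ZERO when the colour factor kills the colour vector: the second response's SOURCE `−𝕄ₜ′·rₛ′ = −(C_θ⊗kₜ)(θ⊗rₛ)` vanishes. -/
theorem kronecker_mulVec_tensor_eq_zero {c : Matrix l l ℝ} {θ : l → ℝ} (h : c *ᵥ θ = 0) (K : Matrix α ν ℝ) (v : ν → ℝ) :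
    (c ⊗ₖ K) *ᵥ (fun p : l × ν => θ p.1 * v p.2) = 0 := by
  rw [kronecker_mulVec_tensor, h]
  ext ⟨i, x⟩
  simp

variable [DecidableEq l]

/-- [folklore] The colour-blind base on a colour-vector-valued vector: `(1 ⊗ 𝕄₀)(θ ⊗ r) = θ ⊗ (𝕄₀ r)`. -/
theorem one_kronecker_mulVec_tensor (K : Matrix α ν ℝ) (θ : l → ℝ) (v : ν → ℝ) :
    (((1 : Matrix l l ℝ) ⊗ₖ K) *ᵥ fun p : l × ν => θ p.1 * v p.2) = fun q : l × α => θ q.1 * (K *ᵥ v) q.2 := by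
  rw [kronecker_mulVec_tensor, Matrix.one_mulVec]

end Pack

/-! ## §3 `packedWard₂` over the lifted index: `hst` and the odd part are `0 = 0` -/

section LiftWard

variable {l σ ρ' : Type*} [Fintype l] [Fintype σ] [DecidableEq l]

/-- [folklore] **THE LIFTED PACKED WARD RELATION OF THE EVEN TUPLE.**  Lifted index `σ′ = l × σ`, any `ρ′`; base `𝕄₀′ = 1⊗𝕄₀`, gauge basis
`Ŵ₀′ = 1⊗Ŵ₀`; first tables `𝕄₁′ (γ,k) = C γ ⊗ 𝕄₁ k`, generator tables `X₁′ (γ,k) = C γ ⊗ X₁ k`; GENERAL second tables `𝕄₂′`, `X₂′`; HYPOTHESES: the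
lifted table-level letters [P1′] (every direction) and [P2′] (every pair), the FIRST-order source conditions for the weights `θ ⊗ rₛ`, `θ ⊗ rₜ`, and
`(Σ θ•C) θ = 0` (the generator kills the response's colour).  CONCLUSION (`packedWard₂` at second weight `0`, its `hst` DISCHARGED because
`𝕄ₜ′·rₛ′ = (C_θ θ) ⊗ (kₜ rₛ) = 0`): the mixed Ward letter of the EVEN packed tuple, with NO odd part:
`K_e′·(1⊗Ŵ₀) + (C_θ⊗kₛ)·(C_θ⊗wₜ) + (C_θ⊗kₜ)·(C_θ⊗wₛ) + (1⊗𝕄₀)·W_e′ = 0`. -/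
theorem packedWard₂_lift_even (C : l → Matrix l l ℝ) (θ : l → ℝ) (hθ : (∑ γ, θ γ • C γ) *ᵥ θ = 0)
    (𝕄₀ : Matrix σ σ ℝ) (𝕄₁ : σ → Matrix σ σ ℝ) (Ŵ₀ : Matrix σ ρ' ℝ) (X₁ : σ → Matrix σ ρ' ℝ)
    (𝕄₂' : l × σ → l × σ → Matrix (l × σ) (l × σ) ℝ) (X₂' : l × σ → l × σ → Matrix (l × σ) (l × ρ') ℝ)
    (hP1 : ∀ p : l × σ, (C p.1 ⊗ₖ 𝕄₁ p.2) * ((1 : Matrix l l ℝ) ⊗ₖ Ŵ₀) + ((1 : Matrix l l ℝ) ⊗ₖ 𝕄₀) * (C p.1 ⊗ₖ X₁ p.2)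
      + oslot (fun q : l × σ => C q.1 ⊗ₖ X₁ q.2) (fun i => ((1 : Matrix l l ℝ) ⊗ₖ 𝕄₀) i p) = 0)
    (hP2 : ∀ p q : l × σ, 𝕄₂' p q * ((1 : Matrix l l ℝ) ⊗ₖ Ŵ₀) + (C p.1 ⊗ₖ 𝕄₁ p.2) * (C q.1 ⊗ₖ X₁ q.2) + (C q.1 ⊗ₖ 𝕄₁ q.2) * (C p.1 ⊗ₖ X₁ p.2)
      + ((1 : Matrix l l ℝ) ⊗ₖ 𝕄₀) * X₂' p q
      + oslot (fun q' : l × σ => C q'.1 ⊗ₖ X₁ q'.2) (fun i => (C q.1 ⊗ₖ 𝕄₁ q.2) i p)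
      + oslot (X₂' q) (fun i => ((1 : Matrix l l ℝ) ⊗ₖ 𝕄₀) i p) + oslot (X₂' p) (fun i => ((1 : Matrix l l ℝ) ⊗ₖ 𝕄₀) i q) = 0)
    (rs rt : σ → ℝ)
    (hs₂ : ∀ q, oslot (X₂' q) (((1 : Matrix l l ℝ) ⊗ₖ 𝕄₀) *ᵥ fun p : l × σ => θ p.1 * rs p.2) = 0)
    (ht₂ : ∀ p, oslot (X₂' p) (((1 : Matrix l l ℝ) ⊗ₖ 𝕄₀) *ᵥ fun q : l × σ => θ q.1 * rt q.2) = 0) :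
    (∑ p : l × σ, ∑ q : l × σ, ((θ p.1 * rs p.2) * (θ q.1 * rt q.2)) • 𝕄₂' p q) * ((1 : Matrix l l ℝ) ⊗ₖ Ŵ₀)
      + ((∑ γ, θ γ • C γ) ⊗ₖ (∑ k, rs k • 𝕄₁ k)) * ((∑ γ, θ γ • C γ) ⊗ₖ (∑ k, rt k • X₁ k))
      + ((∑ γ, θ γ • C γ) ⊗ₖ (∑ k, rt k • 𝕄₁ k)) * ((∑ γ, θ γ • C γ) ⊗ₖ (∑ k, rs k • X₁ k))
      + ((1 : Matrix l l ℝ) ⊗ₖ 𝕄₀) * (∑ p : l × σ, ∑ q : l × σ, ((θ p.1 * rs p.2) * (θ q.1 * rt q.2)) • X₂' p q) = 0 := by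
  -- the packed first jets
  have hMs : ∑ p : l × σ, (θ p.1 * rs p.2) • (C p.1 ⊗ₖ 𝕄₁ p.2) = (∑ γ, θ γ • C γ) ⊗ₖ (∑ k, rs k • 𝕄₁ k) := sum_smul_kronecker_pack _ _ _ _
  have hMt : ∑ p : l × σ, (θ p.1 * rt p.2) • (C p.1 ⊗ₖ 𝕄₁ p.2) = (∑ γ, θ γ • C γ) ⊗ₖ (∑ k, rt k • 𝕄₁ k) := sum_smul_kronecker_pack _ _ _ _
  have hWs : ∑ p : l × σ, (θ p.1 * rs p.2) • (C p.1 ⊗ₖ X₁ p.2) = (∑ γ, θ γ • C γ) ⊗ₖ (∑ k, rs k • X₁ k) := sum_smul_kronecker_pack _ _ _ _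
  have hWt : ∑ p : l × σ, (θ p.1 * rt p.2) • (C p.1 ⊗ₖ X₁ p.2) = (∑ γ, θ γ • C γ) ⊗ₖ (∑ k, rt k • X₁ k) := sum_smul_kronecker_pack _ _ _ _
  -- `hst` DISCHARGED: the second weight is `0` and `𝕄ₜ′ · rₛ′ = (C_θ θ) ⊗ (kₜ rₛ) = 0`
  have hst : oslot (fun q : l × σ => C q.1 ⊗ₖ X₁ q.2)
      (((1 : Matrix l l ℝ) ⊗ₖ 𝕄₀) *ᵥ (0 : l × σ → ℝ) + (∑ p : l × σ, (θ p.1 * rt p.2) • (C p.1 ⊗ₖ 𝕄₁ p.2)) *ᵥ fun p : l × σ => θ p.1 * rs p.2) = 0 := by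
    rw [Matrix.mulVec_zero, zero_add, hMt, kronecker_mulVec_tensor_eq_zero hθ, oslot_zero]
  have h := packedWard₂ ((1 : Matrix l l ℝ) ⊗ₖ 𝕄₀) (fun p : l × σ => C p.1 ⊗ₖ 𝕄₁ p.2) 𝕄₂' ((1 : Matrix l l ℝ) ⊗ₖ Ŵ₀)
    (fun p : l × σ => C p.1 ⊗ₖ X₁ p.2) X₂' hP1 hP2 (fun p => θ p.1 * rs p.2) (fun p => θ p.1 * rt p.2) 0 hs₂ ht₂ hst
  simp only [Pi.zero_apply, zero_smul, Finset.sum_const_zero, add_zero] at h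
  rw [hMs, hMt, hWs, hWt] at h
  exact h

/-- [folklore] **FIRST ORDER, LIFTED**: `packedWard₁` over `σ′ = l × σ` with weight `θ ⊗ r` (source condition as hypothesis): `(C_θ⊗kₛ)(1⊗Ŵ₀) + (1⊗𝕄₀)(C_θ⊗wₛ) = 0`. -/
theorem packedWard₁_lift (C : l → Matrix l l ℝ) (θ : l → ℝ) (𝕄₀ : Matrix σ σ ℝ) (𝕄₁ : σ → Matrix σ σ ℝ) (Ŵ₀ : Matrix σ ρ' ℝ) (X₁ : σ → Matrix σ ρ' ℝ)
    (hP1 : ∀ p : l × σ, (C p.1 ⊗ₖ 𝕄₁ p.2) * ((1 : Matrix l l ℝ) ⊗ₖ Ŵ₀) + ((1 : Matrix l l ℝ) ⊗ₖ 𝕄₀) * (C p.1 ⊗ₖ X₁ p.2)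
      + oslot (fun q : l × σ => C q.1 ⊗ₖ X₁ q.2) (fun i => ((1 : Matrix l l ℝ) ⊗ₖ 𝕄₀) i p) = 0)
    (r : σ → ℝ) (hsrc : oslot (fun q : l × σ => C q.1 ⊗ₖ X₁ q.2) (((1 : Matrix l l ℝ) ⊗ₖ 𝕄₀) *ᵥ fun p : l × σ => θ p.1 * r p.2) = 0) :
    ((∑ γ, θ γ • C γ) ⊗ₖ (∑ k, r k • 𝕄₁ k)) * ((1 : Matrix l l ℝ) ⊗ₖ Ŵ₀) + ((1 : Matrix l l ℝ) ⊗ₖ 𝕄₀) * ((∑ γ, θ γ • C γ) ⊗ₖ (∑ k, r k • X₁ k)) = 0 := by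
  have h := packedWard₁ ((1 : Matrix l l ℝ) ⊗ₖ 𝕄₀) (fun p : l × σ => C p.1 ⊗ₖ 𝕄₁ p.2) ((1 : Matrix l l ℝ) ⊗ₖ Ŵ₀) (fun p : l × σ => C p.1 ⊗ₖ X₁ p.2)
    hP1 (fun p => θ p.1 * r p.2) hsrc
  rwa [sum_smul_kronecker_pack, sum_smul_kronecker_pack] at h

end LiftWard

/-! ## §4 Structured second tables: the COLOURLESS letters of the even tuple, derived -/

section Colourless

variable {l σ ρ' : Type*} [Fintype l] [Fintype σ] [DecidableEq l]

/-- [folklore] **THE LIFTED EVEN LETTER IN KRONECKER FORM** for second tables `𝕄₂′ = (C γ·C δ) ⊗ 𝕄₂ k l`, `X₂′ = (C γ·C δ) ⊗ X₂ k l`: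
`(C_θ·C_θ) ⊗ (k_e·Ŵ₀ + kₛ·wₜ + kₜ·wₛ + 𝕄₀·w_e) = 0`, `k_e := Σ rₛrₜ•𝕄₂`, `w_e := Σ rₛrₜ•X₂`, `kₛ := Σ rₛ•𝕄₁`, `wₛ := Σ rₛ•X₁`. -/
theorem packedWard₂_lift_even_kronecker (C : l → Matrix l l ℝ) (θ : l → ℝ) (hθ : (∑ γ, θ γ • C γ) *ᵥ θ = 0)
    (𝕄₀ : Matrix σ σ ℝ) (𝕄₁ : σ → Matrix σ σ ℝ) (𝕄₂ : σ → σ → Matrix σ σ ℝ) (Ŵ₀ : Matrix σ ρ' ℝ) (X₁ : σ → Matrix σ ρ' ℝ)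
    (X₂ : σ → σ → Matrix σ ρ' ℝ)
    (hP1 : ∀ p : l × σ, (C p.1 ⊗ₖ 𝕄₁ p.2) * ((1 : Matrix l l ℝ) ⊗ₖ Ŵ₀) + ((1 : Matrix l l ℝ) ⊗ₖ 𝕄₀) * (C p.1 ⊗ₖ X₁ p.2)
      + oslot (fun q : l × σ => C q.1 ⊗ₖ X₁ q.2) (fun i => ((1 : Matrix l l ℝ) ⊗ₖ 𝕄₀) i p) = 0)
    (hP2 : ∀ p q : l × σ, ((C p.1 * C q.1) ⊗ₖ 𝕄₂ p.2 q.2) * ((1 : Matrix l l ℝ) ⊗ₖ Ŵ₀) + (C p.1 ⊗ₖ 𝕄₁ p.2) * (C q.1 ⊗ₖ X₁ q.2)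
      + (C q.1 ⊗ₖ 𝕄₁ q.2) * (C p.1 ⊗ₖ X₁ p.2) + ((1 : Matrix l l ℝ) ⊗ₖ 𝕄₀) * ((C p.1 * C q.1) ⊗ₖ X₂ p.2 q.2)
      + oslot (fun q' : l × σ => C q'.1 ⊗ₖ X₁ q'.2) (fun i => (C q.1 ⊗ₖ 𝕄₁ q.2) i p)
      + oslot (fun q' : l × σ => (C q.1 * C q'.1) ⊗ₖ X₂ q.2 q'.2) (fun i => ((1 : Matrix l l ℝ) ⊗ₖ 𝕄₀) i p)
      + oslot (fun p' : l × σ => (C p.1 * C p'.1) ⊗ₖ X₂ p.2 p'.2) (fun i => ((1 : Matrix l l ℝ) ⊗ₖ 𝕄₀) i q) = 0)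
    (rs rt : σ → ℝ)
    (hs₂ : ∀ q : l × σ, oslot (fun q' : l × σ => (C q.1 * C q'.1) ⊗ₖ X₂ q.2 q'.2) (((1 : Matrix l l ℝ) ⊗ₖ 𝕄₀) *ᵥ fun p : l × σ => θ p.1 * rs p.2) = 0)
    (ht₂ : ∀ p : l × σ, oslot (fun p' : l × σ => (C p.1 * C p'.1) ⊗ₖ X₂ p.2 p'.2) (((1 : Matrix l l ℝ) ⊗ₖ 𝕄₀) *ᵥ fun q : l × σ => θ q.1 * rt q.2) = 0) :
    ((∑ γ, θ γ • C γ) * (∑ γ, θ γ • C γ)) ⊗ₖ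
      ((∑ k, ∑ l', (rs k * rt l') • 𝕄₂ k l') * Ŵ₀ + (∑ k, rs k • 𝕄₁ k) * (∑ k, rt k • X₁ k) + (∑ k, rt k • 𝕄₁ k) * (∑ k, rs k • X₁ k)
        + 𝕄₀ * (∑ k, ∑ l', (rs k * rt l') • X₂ k l')) = 0 := by
  have h := packedWard₂_lift_even C θ hθ 𝕄₀ 𝕄₁ Ŵ₀ X₁ (fun p q => (C p.1 * C q.1) ⊗ₖ 𝕄₂ p.2 q.2) (fun p q => (C p.1 * C q.1) ⊗ₖ X₂ p.2 q.2)
    hP1 hP2 rs rt hs₂ ht₂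
  rw [sum_sum_smul_kronecker_pack₂, sum_sum_smul_kronecker_pack₂, ← Matrix.mul_kronecker_mul, ← Matrix.mul_kronecker_mul,
    ← Matrix.mul_kronecker_mul, ← Matrix.mul_kronecker_mul, Matrix.mul_one, Matrix.one_mul, ← Matrix.kronecker_add, ← Matrix.kronecker_add,
    ← Matrix.kronecker_add] at h
  exact h

omit [Fintype l] [Fintype σ] [DecidableEq l] in
/-- [folklore] CANCELLING A NONZERO KRONECKER FACTOR (one direction of `PackedWardLiftOddDrop.kronecker_eq_zero_iff_right`, re-derived to keep this
file's imports light): `A ≠ 0`, `A ⊗ B = 0` ⟹ `B = 0`. -/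
theorem eq_zero_of_kronecker_eq_zero {m n p q : Type*} {A : Matrix m n ℝ} (hA : A ≠ 0) {B : Matrix p q ℝ} (h : A ⊗ₖ B = 0) : B = 0 := by
  obtain ⟨i, j, hij⟩ : ∃ i j, A i j ≠ 0 := by
    by_contra hcon
    exact hA (Matrix.ext fun i j => by by_contra h'; exact hcon ⟨i, j, h'⟩)
  ext x y
  have := congrFun (congrFun h (i, x)) (j, y)
  rw [Matrix.kroneckerMap_apply, Matrix.zero_apply, mul_eq_zero] at this
  exact this.resolve_left hij

/-- [folklore] **THE COLOURLESS MIXED LETTER OF THE EVEN TUPLE, DERIVED** (no odd part, no `R`, nothing displayed beyond the lifted table-level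
letters): for `C_θ·C_θ ≠ 0`, `k_e·Ŵ₀ + kₛ·wₜ + kₜ·wₛ + 𝕄₀·w_e = 0` — the packed-form input; read out on `ν ⊕ μ` by §4b `ward₂_even_of_lift`
(= `WardJetsUnpacked.ward₂`'s unpacking, VERBATIM) into the binders `aₛₜ`∕`bₛₜ` of `identity_array_currency_cov_What0_stripped` for the EVEN packed data. -/
theorem packedWard₂_even_of_lift (C : l → Matrix l l ℝ) (θ : l → ℝ) (hθ : (∑ γ, θ γ • C γ) *ᵥ θ = 0)
    (hC : (∑ γ, θ γ • C γ) * (∑ γ, θ γ • C γ) ≠ 0)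
    (𝕄₀ : Matrix σ σ ℝ) (𝕄₁ : σ → Matrix σ σ ℝ) (𝕄₂ : σ → σ → Matrix σ σ ℝ) (Ŵ₀ : Matrix σ ρ' ℝ) (X₁ : σ → Matrix σ ρ' ℝ)
    (X₂ : σ → σ → Matrix σ ρ' ℝ)
    (hP1 : ∀ p : l × σ, (C p.1 ⊗ₖ 𝕄₁ p.2) * ((1 : Matrix l l ℝ) ⊗ₖ Ŵ₀) + ((1 : Matrix l l ℝ) ⊗ₖ 𝕄₀) * (C p.1 ⊗ₖ X₁ p.2)
      + oslot (fun q : l × σ => C q.1 ⊗ₖ X₁ q.2) (fun i => ((1 : Matrix l l ℝ) ⊗ₖ 𝕄₀) i p) = 0)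
    (hP2 : ∀ p q : l × σ, ((C p.1 * C q.1) ⊗ₖ 𝕄₂ p.2 q.2) * ((1 : Matrix l l ℝ) ⊗ₖ Ŵ₀) + (C p.1 ⊗ₖ 𝕄₁ p.2) * (C q.1 ⊗ₖ X₁ q.2)
      + (C q.1 ⊗ₖ 𝕄₁ q.2) * (C p.1 ⊗ₖ X₁ p.2) + ((1 : Matrix l l ℝ) ⊗ₖ 𝕄₀) * ((C p.1 * C q.1) ⊗ₖ X₂ p.2 q.2)
      + oslot (fun q' : l × σ => C q'.1 ⊗ₖ X₁ q'.2) (fun i => (C q.1 ⊗ₖ 𝕄₁ q.2) i p)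
      + oslot (fun q' : l × σ => (C q.1 * C q'.1) ⊗ₖ X₂ q.2 q'.2) (fun i => ((1 : Matrix l l ℝ) ⊗ₖ 𝕄₀) i p)
      + oslot (fun p' : l × σ => (C p.1 * C p'.1) ⊗ₖ X₂ p.2 p'.2) (fun i => ((1 : Matrix l l ℝ) ⊗ₖ 𝕄₀) i q) = 0)
    (rs rt : σ → ℝ)
    (hs₂ : ∀ q : l × σ, oslot (fun q' : l × σ => (C q.1 * C q'.1) ⊗ₖ X₂ q.2 q'.2) (((1 : Matrix l l ℝ) ⊗ₖ 𝕄₀) *ᵥ fun p : l × σ => θ p.1 * rs p.2) = 0)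
    (ht₂ : ∀ p : l × σ, oslot (fun p' : l × σ => (C p.1 * C p'.1) ⊗ₖ X₂ p.2 p'.2) (((1 : Matrix l l ℝ) ⊗ₖ 𝕄₀) *ᵥ fun q : l × σ => θ q.1 * rt q.2) = 0) :
    (∑ k, ∑ l', (rs k * rt l') • 𝕄₂ k l') * Ŵ₀ + (∑ k, rs k • 𝕄₁ k) * (∑ k, rt k • X₁ k) + (∑ k, rt k • 𝕄₁ k) * (∑ k, rs k • X₁ k)
      + 𝕄₀ * (∑ k, ∑ l', (rs k * rt l') • X₂ k l') = 0 :=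
  eq_zero_of_kronecker_eq_zero hC (packedWard₂_lift_even_kronecker C θ hθ 𝕄₀ 𝕄₁ 𝕄₂ Ŵ₀ X₁ X₂ hP1 hP2 rs rt hs₂ ht₂)

/-- [folklore] **FIRST ORDER, COLOURLESS, DERIVED**: for `C_θ ≠ 0`, `kₛ·Ŵ₀ + 𝕄₀·wₛ = 0` from the lifted [P1′] and the lifted source condition. -/
theorem packedWard₁_of_lift (C : l → Matrix l l ℝ) (θ : l → ℝ) (hC : (∑ γ, θ γ • C γ) ≠ 0)
    (𝕄₀ : Matrix σ σ ℝ) (𝕄₁ : σ → Matrix σ σ ℝ) (Ŵ₀ : Matrix σ ρ' ℝ) (X₁ : σ → Matrix σ ρ' ℝ)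
    (hP1 : ∀ p : l × σ, (C p.1 ⊗ₖ 𝕄₁ p.2) * ((1 : Matrix l l ℝ) ⊗ₖ Ŵ₀) + ((1 : Matrix l l ℝ) ⊗ₖ 𝕄₀) * (C p.1 ⊗ₖ X₁ p.2)
      + oslot (fun q : l × σ => C q.1 ⊗ₖ X₁ q.2) (fun i => ((1 : Matrix l l ℝ) ⊗ₖ 𝕄₀) i p) = 0)
    (r : σ → ℝ) (hsrc : oslot (fun q : l × σ => C q.1 ⊗ₖ X₁ q.2) (((1 : Matrix l l ℝ) ⊗ₖ 𝕄₀) *ᵥ fun p : l × σ => θ p.1 * r p.2) = 0) :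
    (∑ k, r k • 𝕄₁ k) * Ŵ₀ + 𝕄₀ * (∑ k, r k • X₁ k) = 0 := by
  have h := packedWard₁_lift C θ 𝕄₀ 𝕄₁ Ŵ₀ X₁ hP1 r hsrc
  rw [← Matrix.mul_kronecker_mul, ← Matrix.mul_kronecker_mul, Matrix.mul_one, Matrix.one_mul, ← Matrix.kronecker_add] at h
  exact eq_zero_of_kronecker_eq_zero hC h

end Colourless

/-! ## §4b The `ν ⊕ μ` read-out: binders `aₛₜ`, `bₛₜ` (and `aₛ`, `bₛ`) of the EVEN packed tuple, derived -/

section Readout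

variable {l ν μ ρ : Type*} [Fintype l] [Fintype ν] [Fintype μ] [DecidableEq l]

omit [Fintype l] [DecidableEq l] in
/-- [folklore] UNPACKING a packed-form mixed letter on `ν ⊕ μ` into its field and multiplier blocks. -/
theorem unpack_mixed_letter (K₀ Kₛ Kₜ Kₛₜ : Matrix ν ν ℝ) (Q₀ Qₛ Qₜ Qₛₜ : Matrix μ ν ℝ) (W₀ wₛ wₜ wₛₜ : Matrix ν ρ ℝ)
    (h : kkt Kₛₜ Qₛₜ * fromRows W₀ (0 : Matrix μ ρ ℝ) + kkt Kₛ Qₛ * fromRows wₜ (0 : Matrix μ ρ ℝ) + kkt Kₜ Qₜ * fromRows wₛ (0 : Matrix μ ρ ℝ)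
      + kkt K₀ Q₀ * fromRows wₛₜ (0 : Matrix μ ρ ℝ) = 0) :
    Kₛₜ * W₀ + Kₛ * wₜ + Kₜ * wₛ + K₀ * wₛₜ = 0 ∧ Qₛₜ * W₀ + Qₛ * wₜ + Qₜ * wₛ + Q₀ * wₛₜ = 0 := by
  rw [kkt_mul_fromRows_zero, kkt_mul_fromRows_zero, kkt_mul_fromRows_zero, kkt_mul_fromRows_zero, fromRows_add_fromRows, fromRows_add_fromRows,
    fromRows_add_fromRows, fromRows_eq_zero_iff] at h
  exact h

/-- [folklore] **`aₛₜ` AND `bₛₜ` OF THE EVEN PACKED TUPLE, DERIVED IN THE COLOUR-VECTOR MODEL** — `packedWard₂_even_of_lift` at `kkt`-tables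
`𝕄ᵢ = kkt Kᵢ Qᵢ`, field-rows generators `fromRows x 0`, read out on `ν ⊕ μ`: with `K_e := Σ rₛrₜ•K₂`, `Q_e`, `w_e := Σ rₛrₜ•x₂`, `Kₛ := Σ rₛ•K₁`, …:
`K_e·W₀ + Kₛ·wₜ + Kₜ·wₛ + K₀·w_e = 0 ∧ Q_e·W₀ + Qₛ·wₜ + Qₜ·wₛ + Q₀·w_e = 0` — the binders of `identity_array_currency_cov_What0_stripped` for EVEN
packed data, with NO odd part and NO displayed second-order letter beyond the lifted table-level [P1′]∕[P2′] and the first-order source conditions. -/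
theorem ward₂_even_of_lift (C : l → Matrix l l ℝ) (θ : l → ℝ) (hθ : (∑ γ, θ γ • C γ) *ᵥ θ = 0)
    (hC : (∑ γ, θ γ • C γ) * (∑ γ, θ γ • C γ) ≠ 0)
    (K₀ : Matrix ν ν ℝ) (Q₀ : Matrix μ ν ℝ) (K₁ : ν ⊕ μ → Matrix ν ν ℝ) (Q₁ : ν ⊕ μ → Matrix μ ν ℝ)
    (K₂ : ν ⊕ μ → ν ⊕ μ → Matrix ν ν ℝ) (Q₂ : ν ⊕ μ → ν ⊕ μ → Matrix μ ν ℝ)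
    (W₀ : Matrix ν ρ ℝ) (x₁ : ν ⊕ μ → Matrix ν ρ ℝ) (x₂ : ν ⊕ μ → ν ⊕ μ → Matrix ν ρ ℝ)
    (hP1 : ∀ p : l × (ν ⊕ μ), (C p.1 ⊗ₖ kkt (K₁ p.2) (Q₁ p.2)) * ((1 : Matrix l l ℝ) ⊗ₖ fromRows W₀ (0 : Matrix μ ρ ℝ))
      + ((1 : Matrix l l ℝ) ⊗ₖ kkt K₀ Q₀) * (C p.1 ⊗ₖ fromRows (x₁ p.2) (0 : Matrix μ ρ ℝ))
      + oslot (fun q : l × (ν ⊕ μ) => C q.1 ⊗ₖ fromRows (x₁ q.2) (0 : Matrix μ ρ ℝ)) (fun i => ((1 : Matrix l l ℝ) ⊗ₖ kkt K₀ Q₀) i p) = 0)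
    (hP2 : ∀ p q : l × (ν ⊕ μ), ((C p.1 * C q.1) ⊗ₖ kkt (K₂ p.2 q.2) (Q₂ p.2 q.2)) * ((1 : Matrix l l ℝ) ⊗ₖ fromRows W₀ (0 : Matrix μ ρ ℝ))
      + (C p.1 ⊗ₖ kkt (K₁ p.2) (Q₁ p.2)) * (C q.1 ⊗ₖ fromRows (x₁ q.2) (0 : Matrix μ ρ ℝ))
      + (C q.1 ⊗ₖ kkt (K₁ q.2) (Q₁ q.2)) * (C p.1 ⊗ₖ fromRows (x₁ p.2) (0 : Matrix μ ρ ℝ))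
      + ((1 : Matrix l l ℝ) ⊗ₖ kkt K₀ Q₀) * ((C p.1 * C q.1) ⊗ₖ fromRows (x₂ p.2 q.2) (0 : Matrix μ ρ ℝ))
      + oslot (fun q' : l × (ν ⊕ μ) => C q'.1 ⊗ₖ fromRows (x₁ q'.2) (0 : Matrix μ ρ ℝ)) (fun i => (C q.1 ⊗ₖ kkt (K₁ q.2) (Q₁ q.2)) i p)
      + oslot (fun q' : l × (ν ⊕ μ) => (C q.1 * C q'.1) ⊗ₖ fromRows (x₂ q.2 q'.2) (0 : Matrix μ ρ ℝ)) (fun i => ((1 : Matrix l l ℝ) ⊗ₖ kkt K₀ Q₀) i p)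
      + oslot (fun p' : l × (ν ⊕ μ) => (C p.1 * C p'.1) ⊗ₖ fromRows (x₂ p.2 p'.2) (0 : Matrix μ ρ ℝ)) (fun i => ((1 : Matrix l l ℝ) ⊗ₖ kkt K₀ Q₀) i q)
        = 0)
    (rs rt : ν ⊕ μ → ℝ)
    (hs₂ : ∀ q : l × (ν ⊕ μ), oslot (fun q' : l × (ν ⊕ μ) => (C q.1 * C q'.1) ⊗ₖ fromRows (x₂ q.2 q'.2) (0 : Matrix μ ρ ℝ))
      (((1 : Matrix l l ℝ) ⊗ₖ kkt K₀ Q₀) *ᵥ fun p : l × (ν ⊕ μ) => θ p.1 * rs p.2) = 0)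
    (ht₂ : ∀ p : l × (ν ⊕ μ), oslot (fun p' : l × (ν ⊕ μ) => (C p.1 * C p'.1) ⊗ₖ fromRows (x₂ p.2 p'.2) (0 : Matrix μ ρ ℝ))
      (((1 : Matrix l l ℝ) ⊗ₖ kkt K₀ Q₀) *ᵥ fun q : l × (ν ⊕ μ) => θ q.1 * rt q.2) = 0) :
    (∑ k, ∑ l', (rs k * rt l') • K₂ k l') * W₀ + (∑ k, rs k • K₁ k) * (∑ k, rt k • x₁ k) + (∑ k, rt k • K₁ k) * (∑ k, rs k • x₁ k)
        + K₀ * (∑ k, ∑ l', (rs k * rt l') • x₂ k l') = 0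
    ∧ (∑ k, ∑ l', (rs k * rt l') • Q₂ k l') * W₀ + (∑ k, rs k • Q₁ k) * (∑ k, rt k • x₁ k) + (∑ k, rt k • Q₁ k) * (∑ k, rs k • x₁ k)
        + Q₀ * (∑ k, ∑ l', (rs k * rt l') • x₂ k l') = 0 := by
  have h := packedWard₂_even_of_lift C θ hθ hC (kkt K₀ Q₀) (fun k => kkt (K₁ k) (Q₁ k)) (fun k l' => kkt (K₂ k l') (Q₂ k l'))
    (fromRows W₀ (0 : Matrix μ ρ ℝ)) (fun k => fromRows (x₁ k) (0 : Matrix μ ρ ℝ)) (fun k l' => fromRows (x₂ k l') (0 : Matrix μ ρ ℝ))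
    hP1 hP2 rs rt hs₂ ht₂
  rw [sum_sum_smul_kkt, sum_smul_kkt, sum_smul_kkt, sum_smul_fromRows_zero, sum_smul_fromRows_zero, sum_sum_smul_fromRows_zero] at h
  exact unpack_mixed_letter _ _ _ _ _ _ _ _ _ _ _ _ h

end Readout

end Summit.QuantumFields.BalabanUV.Beta.D1BFx.ColourVectorLift

end
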